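import Summits.QuantumFields.YangMills.Theorems.BalabanUVNodesN08SlotOfRecordFromAlphaACMassBoundAE
import Summits.QuantumFields.YangMills.Theorems.BalabanUVNodesN08LargeFieldRowZBudget

/-!
# BalabanUVNodes ∕ N08 — THE HISTORY-EXTENSIVE MASS LETTER, II: THE SLOT OF RECORD `Node00.PrintedUV3V N L` FROM THE (α)-AC ROWS AND THE `dU`-a.e. BOUND
# `m_k(h,·) ≤ exp(c_m|T₁^{(k)}| + d(𝔤)c₁·Σ_{j<k}|Z_j(h)|)` ON PRINT'S ITERATED RADON–NIKODYM HISTORY MASSES — the re-massed AC tower with a HISTORY-DEPENDENT cap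

Track A, DAG node N08 = T. Bałaban, CMP **102** (1985) 255–275 [Balaban1985UV3]: Thm 1 p. 257 (bounds (5)), Thm 2 p. 272, (41) p. 266 (the history masses AND the Z-terms
«+ Σ_{j=0}^{k−1} O(log g_j⁻¹)|Z_j|»), pp. 273–274; print's averaging (2) = [Balaban1985Averaging] (15) p. 19.  Cell `pub-ymgap`, width seat `pub-ymgap-dag-n08-w1` (g5),
W-SEAT-START-LIST §n08 item 1 successor piece (o19) = file 24; `--supports` K1⁹ `StabilityBRunRowsAtRecordR13SepCoPHV` (stmt-QuantumFields-27364, KEY MAP v2; helper).  Companion of file 23 (`…N08LargeFieldRowZBudget`: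
B25 for an AC tower under the history-extensive letter, the record's booking has the budget `d(𝔤)·c₁`) and of the re-massed tower files I-b ∕ II ∕ III-a ∕ III-b.

WHAT THIS FILE PROVES (kernel; theorems only, 0 def; nothing of the paper asserted).  Write `β := d(𝔤)·c₁ = 𝔠.lane.carrier.dg · 𝔠.lane.carrier.c₁` (`= 3·d(𝔤)` at the record) and
`|Z_{<k}(h)| := Σ_{j<k}|Z_j(h)|` (`Carriers.ZVol`, the volumes (41)'s Z-terms are booked on).
* §1 ★★ `lf_reMassedZ` — ROW B25 POINTWISE AT THE RE-MASSED TOWER `{ X.toTowerBase 𝔠.lane.carrier with W := W′ }.withSeriesAC 𝔖 _` with the family constant `d + c_m`, from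
  `RunAlphaAC`'s rows `hLF67`∕`h68` and the HISTORY-DEPENDENT cap «`W′_k(h,U) ≤ exp(c_m|T₁^{(k)}| + β·|Z_{<k}(h)|)`» — III-a §1 with file 23 §1 in place of file 15 §1 and the Z-rate read
  with the budget (`zcoefOf_add_le`); every other lane-side hypothesis and the provisos R-E2′ OF RECORD discharged as in III-a.
* §2 ★★ `nonempty_analyticLeaves_reMassedZ` — the WHOLE analytic bundle `UVStability3D.AnalyticLeaves C′ S T′` at the re-massed tower, `C′ = {𝔠.lane.consts with d := d + c_m}`, from
  the (α)-AC rows and the five `W′`-hypotheses WITH THE HISTORY-DEPENDENT CAP (III-a §3 verbatim but for B25 = §1).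
* §3 ★★ `printedUV3G_at_record_of_alphaAC_of_reMassedZ_of_window` — `PrintedUV3G` at the record's binders along such re-massed inputs, given the window (III-b §1's twin).
* §4 ★★★ `printedUV3V_at_slotOfRecord_of_alphaAC_of_massBoundZAE_of_consts` — **THE SLOT OF RECORD `Node00.PrintedUV3V N L` for AC inputs AT PRINT'S OWN AVERAGING pinned to
  the record, from `RunAlphaAC` on the family ∧ «`massRecAC … (X S).av k h ≤ exp(c_m|T₁^{(k)}| + β·|Z_{<k}(h)|)` `dU_k`-ALMOST EVERYWHERE, `1 ≤ k ≤ K`» ∧ `b₀p₀^{p₀}e^{1−p₀} ≤ εbg`** —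
  the re-massing CHOSEN INSIDE THE PROOF: `W′_k(h,·) = min (massRecAC … k h) (exp(c_k + β|Z_{<k}(h)|))`, `c_0 = 0`, `c_k = c_m|T₁^{(k)}|` (`=ᵐ massRecAC` by the bound; `≤` it;
  measurable; `≥ 1` at the trivial history; capped); ★★★ `…_of_consts'` — the A6 ∃X form along file 9 §2's inhabitant, the bound stated X-free on
  `MassesAC.massRecAC M₁ Rcol ε_L ε_S (avOfPrint N S)` — III-b's `…_of_consts'` WITH THE HISTORY-EXTENSIVE ANTECEDENT (III-b's uniform letter is the case «budget
  unused»: `exp(c_m|T₁^{(k)}|) ≤ exp(c_m|T₁^{(k)}| + β|Z_{<k}(h)|)`, so it follows from §4 by monotonicity — not restated).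

LOCATED READING (R4⁷) (count-neutral; owners — plan ∕ node00-def ∕ pub-balaban3d ∕ the n08-w3∕w6 analysis lineage — decide): N08's residual list in AC currency may be read as
the (α)-AC package `RunAlphaAC` + ONE `dU_k`-a.e. bound on print's iterated Radon–Nikodym history masses that is EXTENSIVE IN THE HISTORY'S PAST LARGE-FIELD VOLUMES,
«`m_k(h,·) ≤ exp(c_m|T₁^{(k)}| + 3d(𝔤)·Σ_{j<k}|Z_j(h)|)`» + the numeric window.  The uniform letter of III-b is the case «budget unused»; the full slack of the record's Z-booking
(`(Cz+Cv)(1−g_j) + d(𝔤)c₁ + [(Cz+Cv)+C₅+C₆+|log σ₀|c₁]·log g_j⁻¹` per unit `|Z_j|`, file 23 §2) is larger still and level-dependent — available through file 23 §1's profile form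
if an owner wants it typed at the slot.  Nothing here decides the bound.

HONEST FRAMING: count-neutral helper; the (α)-AC rows and the mass bound are HYPOTHESES = N08's object gap in AC currency; `PrintedUV3V` NOT proved; N08 NOT discharged;
E6′ neither used nor decided; one finite 𝕋⁴ programme at fixed ε, Bałaban AS PRINTED — R4 closes the conditional finite-𝕋⁴ rung `BalabanLadder.UV` only; the Yang–Mills mass
gap (Clay) is NOT proved by any of this; nothing continuum ∕ ℝ⁴ ∕ OS.  No `sorry`, standard axioms.
-/

noncomputable section

open MeasureTheory

namespace Summit.QuantumFields.YangMills.BalabanUVNodes.N08SlotOfRecordFromAlphaACMassBoundZAE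

open scoped Matrix.Norms.L2Operator
open Literature.MathematicalPhysics.QuantumFieldTheory.Balaban1983to89
open Literature.MathematicalPhysics.QuantumFieldTheory.Balaban1983to89.Node00 (SU TFamily₃)
open Literature.MathematicalPhysics.QuantumFieldTheory.Balaban1983to89.B10RunsOfRecord
open Literature.MathematicalPhysics.QuantumFieldTheory.Balaban1985CMP102
open Literature.MathematicalPhysics.QuantumFieldTheory.Balaban1985CMP102.Setting
open Literature.MathematicalPhysics.QuantumFieldTheory.Balaban1985CMP102.Theorems (Family)
open Summit.QuantumFields.Balaban3D
open Summit.QuantumFields.Balaban3D.Carriers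
open Summit.QuantumFields.Balaban3D.Proofs
open Summit.QuantumFields.Balaban3D.Proofs.ScalesArithmetic
open Summit.QuantumFields.Balaban3D.Proofs.Constants (eps0Of consts3_d_eq_log)
open Summit.QuantumFields.Balaban3D.Proofs.FamilyLE (le_of_eps0Of thresholds_of_le)
open Summit.QuantumFields.Balaban3D.Proofs.Family (prov_hb₁ prov_hb₂)
open Summit.QuantumFields.Balaban3D.Proofs.GroupModelLieC (lieC)
open Summit.QuantumFields.Balaban3D.Proofs.TowerAC
open Summit.QuantumFields.Balaban3D.Proofs.SeriesAC
open Summit.QuantumFields.Balaban3D.Proofs.StandardAC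
open Summit.QuantumFields.Balaban3D.Proofs.InputsAC
open Summit.QuantumFields.Balaban3D.Proofs.MassesAC (massRecAC massRecAC_nonneg massRecAC_zero one_le_massRecAC_triv measurable_massRecAC)
open Summit.QuantumFields.Balaban3D.Proofs.AlphaAC (AlphaDataAC StepAlphaAC RunAlphaAC)
open Summit.QuantumFields.Balaban3D.Proofs.Thresholds (gamma71L)
open Summit.QuantumFields.Balaban3D.Proofs.LiftBridge (liftCfg)
open Summit.QuantumFields.Balaban3D.Proofs.Run3SmallFactors (codeZ)
open Summit.QuantumFields.YangMills.BalabanUVNodes.N08Thm2AsPrintedAtSlotOfRecordAC (exists_TFamily₃_of_av_eq exists_externalInputsAC_ofPrint)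
open Summit.QuantumFields.YangMills.BalabanUVNodes.N08Thm2AtRecordFromAlpha (window_of_famConsts pos_of_famConsts consts_adm_of_pos)
open Summit.QuantumFields.YangMills.BalabanUVNodes.N08SlotOfRecordFromAlphaAC (printedUV3G_of_analyticLeaves_towerAC3_of_window bound25_vac_of_alphaAC)
open Summit.QuantumFields.YangMills.BalabanUVNodes.N08ReMassedACStepBounds (reMassed_mass_eq_zero_of_not_admissible)
open Summit.QuantumFields.YangMills.BalabanUVNodes.N08ReMassedACThm2 (exists_stepLeaves_reMassed logZT_le_reMassed step0_reMassed)
open Summit.QuantumFields.YangMills.BalabanUVNodes.N08ReMassedACLeaves (bound46_reMassed usesConsts_reMassed)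
open Summit.QuantumFields.YangMills.BalabanUVNodes.N08LargeFieldRowZBudget (lf_towerAC3_of_massBoundZ_const zcoefOf_add_le budget_nonneg)
open B7Prop1Explicit (hol plaqWord)
open B7Prop1Local (pdevOn loK plaqHiK)
open B7Prop2Explicit (avgIter)
open B10LargeField (xlog)

/-! ## §1 Row B25 POINTWISE at the re-massed tower under the history-dependent cap -/
section Lane

variable {L : ℕ} {S : Scales L} {G : Type} [GaugeGroup G] [MeasurableSpace G] [HaarData G]
  {𝔊 : GroupModel G} {𝔠 : Primitives.AlphaConsts L 𝔊.N} {X : ExternalInputsAC S G}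
  {𝔖 : ∀ k, StepSeries S G ↥(lieC 𝔊) (nblkOf S 𝔠.lane.carrier k) k} {𝔄 : AlphaDataAC 𝔊 𝔠 X 𝔖}
  (hfam : S.g ^ 2 * S.ε₀ ≤ (min 𝔠.gamma0 1) ^ 2)
  (W' : HistWeightsAC S.P G) (B' : TowerBaseAC S G) (hB' : B' = { X.toTowerBase 𝔠.lane.carrier with W := W' })
  (hae : ∀ j, j ≤ S.K → ∀ h : Hist S.P j, W'.mass j h =ᵐ[fieldMeasure S.P j G]
    massRecAC 𝔠.lane.carrier.M₁ (rcolOf S 𝔠.lane.carrier) (eps1Of S 𝔠.lane.carrier) (epsSOf S 𝔠.lane.carrier) X.av j h)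
  (hdom : ∀ (j : ℕ) (h : Hist S.P j) (U : GaugeField S.P j G),
    W'.mass j h U ≤ massRecAC 𝔠.lane.carrier.M₁ (rcolOf S 𝔠.lane.carrier) (eps1Of S 𝔠.lane.carrier) (epsSOf S 𝔠.lane.carrier) X.av j h U)
  (hWm : ∀ (j : ℕ) (h : Hist S.P j), Measurable (W'.mass j h)) (hmt : ∀ (j : ℕ) (U : GaugeField S.P j G), 1 ≤ W'.mass j (Hist.triv S.P j) U)

include hfam hB' hdom in
/-- ★★ **ROW B25 POINTWISE AT THE RE-MASSED TOWER UNDER THE HISTORY-DEPENDENT CAP** `W′_k(h,U) ≤ exp(c_m|T₁^{(k)}| + d(𝔤)c₁·Σ_{j<k}|Z_j(h)|)`, from `RunAlphaAC`'s rows `hLF67`∕`h68`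
(they read `X.UkH` = the re-massed input's composite minimisers): file 23 §1 at the re-massed input, the Z-rate read with the record's budget (`zcoefOf_add_le`), every other
lane-side hypothesis discharged as in III-a §1 — provisos of record unchanged. [cite: Balaban1985UV3, pp.273–274 + (67)–(68) p.273 + (39)–(41) p.266 + (7) p.257] -/
theorem lf_reMassedZ {cm : ℝ} (hcm : 0 ≤ cm)
    (hcap : ∀ k, 1 ≤ k → k ≤ S.K → ∀ (h : Hist S.P k) (U : GaugeField S.P k G),
      W'.mass k h U ≤ Real.exp (cm * S.sites k + 𝔠.lane.carrier.dg * 𝔠.lane.carrier.c₁ *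
        ∑ j ∈ Finset.range k, (ZVol 𝔠.lane.carrier.M₁ (rcolOf S 𝔠.lane.carrier) k h j : ℝ)))
    (R : RunAlphaAC 𝔊 𝔠 X 𝔖 𝔄) :
    ∀ k, k ≤ (B'.withSeriesAC 𝔖 (piecesParamsOf S 𝔠.lane.carrier)).tower3.toTowerRun.K →
      ∀ U : (B'.withSeriesAC 𝔖 (piecesParamsOf S 𝔠.lane.carrier)).tower3.toTowerRun.Cfg k,
      (B'.withSeriesAC 𝔖 (piecesParamsOf S 𝔠.lane.carrier)).tower3.toTowerRun.LF k U
          (fun h => -((B'.withSeriesAC 𝔖 (piecesParamsOf S 𝔠.lane.carrier)).tower3.toTowerRun.mainT k h U)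
            + (B'.withSeriesAC 𝔖 (piecesParamsOf S 𝔠.lane.carrier)).tower3.toTowerRun.Zterm k h)
        ≤ Real.exp ((𝔠.lane.consts.d + cm) * (B'.withSeriesAC 𝔖 (piecesParamsOf S 𝔠.lane.carrier)).tower3.toTowerRun.sites k) := by
  subst hB'
  have hr₀ : 0 ≤ 𝔠.lane.carrier.r₀ := le_trans zero_le_one 𝔠.one_le_r₀
  have hCz : 0 ≤ 𝔠.lane.carrier.Cz + 𝔠.lane.carrier.Cv := add_nonneg 𝔠.Cz_nonneg 𝔠.Cv_nonneg
  have hc₁ : 0 ≤ 𝔠.lane.carrier.c₁ := by show (0 : ℝ) ≤ 3; norm_num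
  have hA : 0 ≤ (𝔠.lane.carrier.Cz + 𝔠.lane.carrier.Cv) + 𝔠.lane.carrier.C₅ + 𝔠.lane.carrier.C₆ +
      (|𝔠.lane.carrier.logσ₀| + 𝔠.lane.carrier.dg) * 𝔠.lane.carrier.c₁ := by
    have := 𝔠.lane.carrier.dg_nonneg
    have := abs_nonneg 𝔠.lane.carrier.logσ₀
    have h5 : 0 ≤ 𝔠.lane.carrier.C₅ := 𝔠.C₅_nonneg
    have h6 : 0 ≤ 𝔠.lane.carrier.C₆ := 𝔠.C₆_nonneg
    positivity
  have hρ : (0 : ℝ) ≤ (𝔠.lane.carrier.R₁ + 1) * 𝔠.lane.carrier.M₁ := by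
    have : 0 ≤ 𝔠.lane.carrier.R₁ := 𝔠.R₁_nonneg
    positivity
  exact lf_towerAC3_of_massBoundZ_const 𝔊 𝔠.lane.consts (consts3_d_eq_log 𝔠.lane.F 𝔠.lane.sc) rfl S.hL.2
    (({ X.toTowerBase 𝔠.lane.carrier with W := W' } : TowerBaseAC S G).withSeriesAC 𝔖 (piecesParamsOf S 𝔠.lane.carrier)) (gs := 1) (ε := S.g0sq)
    (fun k hk => by exact_mod_cast sites_eq_card S k (by omega))
    (fun k h U hh => reMassed_mass_eq_zero_of_not_admissible W' hdom k h U hh)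
    hcm (budget_nonneg 𝔠.lane.carrier hc₁) hcap (g0sq_pos S) 𝔠.C68_pos 𝔠.lane.F.b₀_pos 𝔠.lane.F.p₀_pos
    (fun j => by rw [show 𝔠.lane.consts.g = 1 from rfl, show 𝔠.lane.consts.L = (L : ℝ) from rfl]; exact gk_eq_gRun_norm S j)
    (fun j hj => (thresholds_of_le hfam j hj.le).2.2.2.1) R.hLF67 R.h68 𝔠.lane.F.M₁_pos
    (LargeFieldStd.rcolOf_antitone 𝔠.lane.carrier 𝔠.R₁_nonneg hr₀) hρ hr₀ (LargeFieldStd.rcolOf_le 𝔠.lane.carrier 𝔠.R₁_nonneg hr₀)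
    (LargeFieldStd.zcoefOf_nonneg 𝔠.lane.carrier hCz 𝔠.C₅_nonneg 𝔠.C₆_nonneg hc₁)
    (zcoefOf_add_le S 𝔠.lane.carrier hCz 𝔠.C₅_nonneg 𝔠.C₆_nonneg hc₁) hA
    (fun j hj => ⟨gk_pos S j, gk_le_one S S.gK_le_one j hj⟩) le_rfl 𝔠.prov_r₀p₀ (prov_hb₁ 𝔠 𝔊.N_pos) (prov_hb₂ 𝔠 𝔊.N_pos)

/-! ## §2 The whole analytic bundle at the re-massed tower under the history-dependent cap -/

include hfam hB' hae hdom hWm hmt in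
open Classical in
/-- ★★ **`UVStability3D.AnalyticLeaves C′ S T′` AT THE RE-MASSED TOWER `T′`, `C′ = {𝔠.lane.consts with d := d + c_m}`, FROM THE (α)-AC ROWS AND THE FIVE `W′`-HYPOTHESES WITH THE
HISTORY-DEPENDENT CAP** — III-a §3 verbatim (step leaves from II, (1)₀, no interaction at level 0, B15, B20, B21) but for B25 = §1. [cite: Balaban1985UV3, pp.256–274 (the leaves) + (46) p.267 + (65) p.273 + pp.273–274] -/
theorem nonempty_analyticLeaves_reMassedZ {cm : ℝ} (hcm : 0 ≤ cm)
    (hcap : ∀ k, 1 ≤ k → k ≤ S.K → ∀ (h : Hist S.P k) (U : GaugeField S.P k G),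
      W'.mass k h U ≤ Real.exp (cm * S.sites k + 𝔠.lane.carrier.dg * 𝔠.lane.carrier.c₁ *
        ∑ j ∈ Finset.range k, (ZVol 𝔠.lane.carrier.M₁ (rcolOf S 𝔠.lane.carrier) k h j : ℝ)))
    (R : RunAlphaAC 𝔊 𝔠 X 𝔖 𝔄) :
    Nonempty (UVStability3D.AnalyticLeaves { 𝔠.lane.consts with d := 𝔠.lane.consts.d + cm, d_nonneg := add_nonneg 𝔠.lane.consts.d_nonneg hcm } S
      (B'.withSeriesAC 𝔖 (piecesParamsOf S 𝔠.lane.carrier)).tower3.toTowerRun) := by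
  have hsteps := fun k (hk : k + 1 ≤ S.K) => exists_stepLeaves_reMassed hfam W' B' hB' hae hdom hWm hmt hk (R.steps k hk)
  have hlf := lf_reMassedZ hfam W' B' hB' hdom hcm hcap R
  have h46 := bound46_reMassed hfam W' B' hB' R
  have hZT := fun k (hk : k + 1 ≤ S.K) => logZT_le_reMassed W' B' hB' (R.steps k hk)
  have h0 := step0_reMassed W' B' hB' (𝔖 := 𝔖)
  subst hB'
  refine ⟨{ step0 := h0
            noInt0 := TowerBaseAC.noInteraction0_seriesAC _ 𝔖 _
            steps := fun k hk => (hsteps k hk).choose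
            bound46 := h46
            logZT_le := fun k hk => ?_
            PprT_le := fun k hk => ?_
            lf := hlf
            starT_eq := fun k hk => ?_
            logσ₀_le := fun k hk => ?_
            dg_le := fun k hk => ?_
            rem_eq := fun k hk => ?_ }⟩
  · rw [(hsteps k hk).choose_spec]; exact hZT k hk
  · have hk' : k + 1 ≤ S.K := hk
    rw [(hsteps k hk).choose_spec]
    exact LeavesCumAC.pprT_le_series_stdAC _ 𝔖 (piecesParamsOf S 𝔠.lane.carrier) k (by linarith [𝔠.kappa_ge]) 𝔠.C25_nonneg (by omega) (fun _ => 1)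
      (bound25_vac_of_alphaAC hfam k hk' (R.steps k hk')) (Inputs.nblk_cube_le_sites 𝔠.lane k (by omega))
  · rw [(hsteps k hk).choose_spec]; rfl
  · rw [(hsteps k hk).choose_spec]; exact le_rfl
  · rw [(hsteps k hk).choose_spec]; exact le_rfl
  · rw [(hsteps k hk).choose_spec]; rfl

end Lane

/-! ## §3 The printed pair at the record's binders along re-massed AC inputs with the history-dependent cap -/
section Slot

variable {N : ℕ} [NeZero N] {L : ℕ} {𝔊 : GroupModel (SU N)} {𝔠 : Primitives.AlphaConsts L 𝔊.N} {εbg cm : ℝ}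
  {X : ∀ S : Scales L, ExternalInputsAC S (SU N)}
  {𝔖 : ∀ (S : Scales L) (k : ℕ), StepSeries S (SU N) ↥(lieC 𝔊) (nblkOf S 𝔠.lane.carrier k) k}
  {𝔄 : ∀ S : Scales L, AlphaDataAC 𝔊 𝔠 (X S) (𝔖 S)}

/-- ★★ **`PrintedUV3G` AT THE RECORD'S BINDERS ALONG RE-MASSED AC INPUTS WITH THE HISTORY-DEPENDENT CAP, GIVEN THE WINDOW** (file 14 §3 on §2's bundles at
`C′ = {𝔠.lane.consts with d := d + c_m}`): AC external inputs with the record's minimisers above level 0, `εbg > 0`, the window at every member of `Family L c⋆.eps0`, `RunAlphaAC`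
and the five `W′`-hypotheses at every member — III-b §1's twin. [cite: Balaban1985UV3, Thm 1 p.257 + Thm 2 p.272 + pp.256–274] -/
theorem printedUV3G_at_record_of_alphaAC_of_reMassedZ_of_window (W' : ∀ S : Scales L, HistWeightsAC S.P (SU N))
    (hUk : ∀ (S : Scales L) k (V : GaugeField S.P (k + 1) (SU N)), (X S).Uk k V = UkA N (fun S => (X S).av) S (k + 1) εbg V) (hpos : 0 < εbg)
    (hwin : ∀ S : Family L (eps0Of 𝔠.gamma0), eps1OfPrint
        { eps0 := eps0Of 𝔠.gamma0,
          E := fun S => B10.Ek ((({ (X S).toTowerBase 𝔠.lane.carrier with W := W' S } : TowerBaseAC S (SU N)).withSeriesAC (𝔖 S)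
            (Carriers.piecesParamsOf S 𝔠.lane.carrier)).Estep) S.K 0,
          b₀ := 𝔠.lane.F.b₀, p₀ := 𝔠.lane.F.p₀, εbg := εbg } S.1 0 ≤ εbg ∨ 2 < εbg)
    (R : ∀ S : Family L (eps0Of 𝔠.gamma0), RunAlphaAC 𝔊 𝔠 (X S.1) (𝔖 S.1) (𝔄 S.1)) (hcm : 0 ≤ cm)
    (hae : ∀ S : Family L (eps0Of 𝔠.gamma0), ∀ j, j ≤ S.1.K → ∀ h : Hist S.1.P j, (W' S.1).mass j h =ᵐ[fieldMeasure S.1.P j (SU N)]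
      massRecAC 𝔠.lane.carrier.M₁ (rcolOf S.1 𝔠.lane.carrier) (eps1Of S.1 𝔠.lane.carrier) (epsSOf S.1 𝔠.lane.carrier) (X S.1).av j h)
    (hdom : ∀ S : Family L (eps0Of 𝔠.gamma0), ∀ (j : ℕ) (h : Hist S.1.P j) (U : GaugeField S.1.P j (SU N)), (W' S.1).mass j h U ≤
      massRecAC 𝔠.lane.carrier.M₁ (rcolOf S.1 𝔠.lane.carrier) (eps1Of S.1 𝔠.lane.carrier) (epsSOf S.1 𝔠.lane.carrier) (X S.1).av j h U)
    (hWm : ∀ S : Family L (eps0Of 𝔠.gamma0), ∀ (j : ℕ) (h : Hist S.1.P j), Measurable ((W' S.1).mass j h))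
    (hmt : ∀ S : Family L (eps0Of 𝔠.gamma0), ∀ (j : ℕ) (U : GaugeField S.1.P j (SU N)), 1 ≤ (W' S.1).mass j (Hist.triv S.1.P j) U)
    (hcap : ∀ S : Family L (eps0Of 𝔠.gamma0), ∀ k, 1 ≤ k → k ≤ S.1.K → ∀ (h : Hist S.1.P k) (U : GaugeField S.1.P k (SU N)),
      (W' S.1).mass k h U ≤ Real.exp (cm * S.1.sites k + 𝔠.lane.carrier.dg * 𝔠.lane.carrier.c₁ *
        ∑ j ∈ Finset.range k, (ZVol 𝔠.lane.carrier.M₁ (rcolOf S.1 𝔠.lane.carrier) k h j : ℝ))) :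
    PrintedUV3G N L (runObjects₀A N (fun S => (X S).av)
      (fun S j => (Carriers.run3 ((({ (X S).toTowerBase 𝔠.lane.carrier with W := W' S } : TowerBaseAC S (SU N)).withSeriesAC (𝔖 S)
        (Carriers.piecesParamsOf S 𝔠.lane.carrier)).toRunInput fun _ => True)).T j)
      (Backgrounds.ofAvg N L fun S => (X S).av)) := by
  refine printedUV3G_of_analyticLeaves_towerAC3_of_window
    (fun S => (({ (X S).toTowerBase 𝔠.lane.carrier with W := W' S } : TowerBaseAC S (SU N)).withSeriesAC (𝔖 S) (Carriers.piecesParamsOf S 𝔠.lane.carrier)))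
    { eps0 := eps0Of 𝔠.gamma0,
      E := fun S => B10.Ek ((({ (X S).toTowerBase 𝔠.lane.carrier with W := W' S } : TowerBaseAC S (SU N)).withSeriesAC (𝔖 S)
        (Carriers.piecesParamsOf S 𝔠.lane.carrier)).Estep) S.K 0,
      b₀ := 𝔠.lane.F.b₀, p₀ := 𝔠.lane.F.p₀, εbg := εbg }
    (consts_adm_of_pos 𝔠 hpos _) (fun _ _ => rfl) (fun S k V => hUk S k V) (fun _ => rfl) hwin
    (C := { 𝔠.lane.consts with d := 𝔠.lane.consts.d + cm, d_nonneg := add_nonneg 𝔠.lane.consts.d_nonneg hcm }) 𝔠.lane.normalised (fun S => ?_)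
    (fun S => nonempty_analyticLeaves_reMassedZ (le_of_eps0Of S.1 S.2) (W' S.1) _ rfl (hae S) (hdom S) (hWm S) (hmt S) hcm (hcap S) (R S))
  have u := usesConsts_reMassed (𝔠 := 𝔠) (X := X S.1) (𝔖 := 𝔖 S.1) (W' S.1) _ rfl (fun _ => True)
  exact ⟨u.M₁_eq, u.b₀_eq, u.p₀_eq, u.κ₀_eq, u.rcoef_eq, u.Λvol_nonneg⟩

/-! ## §4 The slot of record from the history-extensive a.e. mass bound: the re-massing chosen inside the proof -/

/-- ★★★ **THE SLOT OF RECORD `Node00.PrintedUV3V N L` FROM THE (α)-AC ROWS AND A `dU`-a.e. HISTORY-EXTENSIVE MASS BOUND, `b₀p₀^{p₀}e^{1−p₀} ≤ εbg`** — AC inputs AT PRINT'S OWN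
AVERAGING (`(X S).av = avOfPrint N S`) pinned to the record; the bound «`massRecAC … (X S).av k h U ≤ exp(c_m|T₁^{(k)}| + d(𝔤)c₁·Σ_{j<k}|Z_j(h)|)` for `dU_k`-a.e. `U`, `1 ≤ k ≤ K`» on the
family; the RE-MASSING `W′ = min (massRecAC) (e^{c_k + d(𝔤)c₁|Z_{<k}(h)|})` is chosen HERE and satisfies §2's five hypotheses by elementary facts.  NO E6′, no pointwise statement about a
Radon–Nikodym version, and — new — no history-uniformity of the bound: the printed Z-terms pay for the past. [cite: Balaban1985UV3, Thm 1 p.257 + Thm 2 p.272 + (41) p.266 + (7) p.257; Balaban1985Averaging, (15) p.19] -/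
theorem printedUV3V_at_slotOfRecord_of_alphaAC_of_massBoundZAE_of_consts (hav : ∀ S, (X S).av = avOfPrint N S)
    (hUk : ∀ (S : Scales L) k (V : GaugeField S.P (k + 1) (SU N)), (X S).Uk k V = UkA N (fun S => (X S).av) S (k + 1) εbg V)
    (hε : 𝔠.lane.F.b₀ * (𝔠.lane.F.p₀ ^ 𝔠.lane.F.p₀ * Real.exp (1 - 𝔠.lane.F.p₀)) ≤ εbg)
    (R : ∀ S : Family L (eps0Of 𝔠.gamma0), RunAlphaAC 𝔊 𝔠 (X S.1) (𝔖 S.1) (𝔄 S.1)) (hcm : 0 ≤ cm)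
    (hmass : ∀ S : Family L (eps0Of 𝔠.gamma0), ∀ k, 1 ≤ k → k ≤ S.1.K → ∀ h : Hist S.1.P k, ∀ᵐ U ∂(fieldMeasure S.1.P k (SU N)),
      massRecAC 𝔠.lane.carrier.M₁ (rcolOf S.1 𝔠.lane.carrier) (eps1Of S.1 𝔠.lane.carrier) (epsSOf S.1 𝔠.lane.carrier) (X S.1).av k h U ≤
        Real.exp (cm * S.1.sites k + 𝔠.lane.carrier.dg * 𝔠.lane.carrier.c₁ *
          ∑ j ∈ Finset.range k, (ZVol 𝔠.lane.carrier.M₁ (rcolOf S.1 𝔠.lane.carrier) k h j : ℝ))) :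
    Node00.PrintedUV3V N L := by
  classical
  have hc₁ : 0 ≤ 𝔠.lane.carrier.c₁ := by show (0 : ℝ) ≤ 3; norm_num
  have hβ : 0 ≤ 𝔠.lane.carrier.dg * 𝔠.lane.carrier.c₁ := budget_nonneg 𝔠.lane.carrier hc₁
  -- the scale profile `c_0 = 0`, `c_k = c_m|T₁^{(k)}|`, and the history's budget `d(𝔤)c₁·Σ_{j<k}|Z_j(h)|`
  let c : ∀ S : Scales L, ℕ → ℝ := fun S k => if k = 0 then 0 else cm * S.sites k
  have hc0 : ∀ S k, 0 ≤ c S k := fun S k => by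
    by_cases hk : k = 0
    · simp only [c, if_pos hk]; exact le_rfl
    · simp only [c, if_neg hk]; exact mul_nonneg hcm (sites_nonneg S k)
  let b : ∀ S : Scales L, (k : ℕ) → Hist S.P k → ℝ := fun S k h =>
    𝔠.lane.carrier.dg * 𝔠.lane.carrier.c₁ * ∑ j ∈ Finset.range k, (ZVol 𝔠.lane.carrier.M₁ (rcolOf S 𝔠.lane.carrier) k h j : ℝ)
  have hb0 : ∀ S k h, 0 ≤ b S k h := fun S k h =>
    mul_nonneg hβ (Finset.sum_nonneg fun j _ => Nat.cast_nonneg _)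
  have hb_zero : ∀ S (h : Hist S.P 0), b S 0 h = 0 := fun S h => by simp only [b, Finset.range_zero, Finset.sum_empty, mul_zero]
  -- the re-massing `min (massRecAC) (e^{c_k + b_k(h)})`
  let W' : ∀ S : Scales L, HistWeightsAC S.P (SU N) := fun S =>
    { mass := fun k h U => min (massRecAC 𝔠.lane.carrier.M₁ (rcolOf S 𝔠.lane.carrier) (eps1Of S 𝔠.lane.carrier) (epsSOf S 𝔠.lane.carrier) (X S).av k h U)
        (Real.exp (c S k + b S k h))
      mass_nonneg := fun k h U => le_min (massRecAC_nonneg _ _ _ _ _ k h U) (Real.exp_pos _).le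
      mass_zero := fun h U => by
        show min (massRecAC 𝔠.lane.carrier.M₁ (rcolOf S 𝔠.lane.carrier) (eps1Of S 𝔠.lane.carrier) (epsSOf S 𝔠.lane.carrier) (X S).av 0 h U)
          (Real.exp (c S 0 + b S 0 h)) = 1
        rw [massRecAC_zero, hb_zero S h]
        simp only [c, if_true, add_zero, Real.exp_zero, min_self] }
  -- the five hypotheses of §2
  have hae : ∀ S : Family L (eps0Of 𝔠.gamma0), ∀ j, j ≤ S.1.K → ∀ h : Hist S.1.P j, (W' S.1).mass j h =ᵐ[fieldMeasure S.1.P j (SU N)]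
      massRecAC 𝔠.lane.carrier.M₁ (rcolOf S.1 𝔠.lane.carrier) (eps1Of S.1 𝔠.lane.carrier) (epsSOf S.1 𝔠.lane.carrier) (X S.1).av j h := by
    intro S j hj h
    by_cases hj0 : j = 0
    · subst hj0
      refine Filter.Eventually.of_forall fun U => ?_
      show min _ _ = _
      rw [massRecAC_zero, hb_zero S.1 h]
      simp only [c, if_true, add_zero, Real.exp_zero, min_self]
    · have h1 : 1 ≤ j := Nat.one_le_iff_ne_zero.mpr hj0
      filter_upwards [hmass S j h1 hj h] with U hU
      show min _ _ = _
      simp only [c, if_neg hj0]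
      exact min_eq_left hU
  have hdom : ∀ S : Family L (eps0Of 𝔠.gamma0), ∀ (j : ℕ) (h : Hist S.1.P j) (U : GaugeField S.1.P j (SU N)), (W' S.1).mass j h U ≤
      massRecAC 𝔠.lane.carrier.M₁ (rcolOf S.1 𝔠.lane.carrier) (eps1Of S.1 𝔠.lane.carrier) (epsSOf S.1 𝔠.lane.carrier) (X S.1).av j h U :=
    fun S j h U => min_le_left _ _
  have hWm : ∀ S : Family L (eps0Of 𝔠.gamma0), ∀ (j : ℕ) (h : Hist S.1.P j), Measurable ((W' S.1).mass j h) :=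
    fun S j h => (measurable_massRecAC _ _ _ _ _ j h).min measurable_const
  have hmt : ∀ S : Family L (eps0Of 𝔠.gamma0), ∀ (j : ℕ) (U : GaugeField S.1.P j (SU N)), 1 ≤ (W' S.1).mass j (Hist.triv S.1.P j) U :=
    fun S j U => le_min (one_le_massRecAC_triv _ _ _ _ _ j U) (Real.one_le_exp (add_nonneg (hc0 S.1 j) (hb0 S.1 j _)))
  have hcap : ∀ S : Family L (eps0Of 𝔠.gamma0), ∀ k, 1 ≤ k → k ≤ S.1.K → ∀ (h : Hist S.1.P k) (U : GaugeField S.1.P k (SU N)),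
      (W' S.1).mass k h U ≤ Real.exp (cm * S.1.sites k + 𝔠.lane.carrier.dg * 𝔠.lane.carrier.c₁ *
        ∑ j ∈ Finset.range k, (ZVol 𝔠.lane.carrier.M₁ (rcolOf S.1 𝔠.lane.carrier) k h j : ℝ)) := by
    intro S k hk1 _ h U
    have hk0 : k ≠ 0 := by omega
    calc (W' S.1).mass k h U ≤ Real.exp (c S.1 k + b S.1 k h) := min_le_right _ _
      _ = _ := by simp only [c, b, if_neg hk0]
  -- the printed pair along the re-massed inputs, then the transfer to the slot of record's own binders
  obtain ⟨𝔗', h'⟩ := exists_TFamily₃_of_av_eq (N := N) (𝔞 := fun S => (X S).av) (funext hav)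
    (fun S j => (Carriers.run3 ((({ (X S).toTowerBase 𝔠.lane.carrier with W := W' S } : TowerBaseAC S (SU N)).withSeriesAC (𝔖 S)
      (Carriers.piecesParamsOf S 𝔠.lane.carrier)).toRunInput fun _ => True)).T j)
  have hR : runObjects₀A N (fun S => (X S).av)
      (fun S j => (Carriers.run3 ((({ (X S).toTowerBase 𝔠.lane.carrier with W := W' S } : TowerBaseAC S (SU N)).withSeriesAC (𝔖 S)
        (Carriers.piecesParamsOf S 𝔠.lane.carrier)).toRunInput fun _ => True)).T j)
      (Backgrounds.ofAvg N L fun S => (X S).av) = runObjects₀T N 𝔗' (Backgrounds.ofPrint N L) :=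
    funext fun c' => funext fun S => h' c' S
  exact ⟨𝔗', hR ▸ printedUV3G_at_record_of_alphaAC_of_reMassedZ_of_window (𝔄 := 𝔄) W' hUk (pos_of_famConsts hε)
    (fun S => window_of_famConsts hε _ S.1) R hcm hae hdom hWm hmt hcap⟩

variable (N L) in
/-- ★★★ **THE SLOT OF RECORD FROM ITS AC RESIDUALS WITH THE HISTORY-EXTENSIVE MASS BOUND STATED `dU`-a.e. ON PRINT'S OWN MASSES — A6 FORM** (file 9 §2's inhabitant: AC external
inputs AT PRINT'S AVERAGING with the record's classes and minimisers EXIST): for every `SU(N)`, `𝔠`, `εbg` with `b₀p₀^{p₀}e^{1−p₀} ≤ εbg`, `c_m ≥ 0`, THERE ARE such inputs `X`, and for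
every expansion data `𝔖` and (α)-AC data `𝔄` over them, **the (α)-AC rows on the family ∧ «`massRecAC … (avOfPrint N S) k h ≤ exp(c_m|T₁^{(k)}| + d(𝔤)c₁·Σ_{j<k}|Z_j(h)|)` `dU_k`-a.e.,
`1 ≤ k ≤ K`» ⇒ `Node00.PrintedUV3V N L`** — III-b's `…_of_consts'` with the HISTORY-EXTENSIVE antecedent: the printed Z-terms of (41) pay for the history's past large-field fibre
volumes. [cite: Balaban1985UV3, Thm 1 p.257 + Thm 2 p.272 + (41) p.266; Balaban1985Averaging, (15) p.19] -/
theorem printedUV3V_at_slotOfRecord_of_alphaAC_of_massBoundZAE_of_consts' (𝔊 : GroupModel (SU N)) (𝔠 : Primitives.AlphaConsts L 𝔊.N) (εbg cm : ℝ)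
    (hε : 𝔠.lane.F.b₀ * (𝔠.lane.F.p₀ ^ 𝔠.lane.F.p₀ * Real.exp (1 - 𝔠.lane.F.p₀)) ≤ εbg) (hcm : 0 ≤ cm) :
    ∃ X : ∀ S : Scales L, ExternalInputsAC S (SU N), (∀ S, (X S).av = avOfPrint N S) ∧
      ∀ (𝔖 : ∀ (S : Scales L) (k : ℕ), StepSeries S (SU N) ↥(lieC 𝔊) (nblkOf S 𝔠.lane.carrier k) k)
        (𝔄 : ∀ S : Scales L, AlphaDataAC 𝔊 𝔠 (X S) (𝔖 S)),
        (∀ S : Family L (eps0Of 𝔠.gamma0), RunAlphaAC 𝔊 𝔠 (X S.1) (𝔖 S.1) (𝔄 S.1)) →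
        (∀ S : Family L (eps0Of 𝔠.gamma0), ∀ k, 1 ≤ k → k ≤ S.1.K → ∀ h : Hist S.1.P k, ∀ᵐ U ∂(fieldMeasure S.1.P k (SU N)),
          massRecAC 𝔠.lane.carrier.M₁ (rcolOf S.1 𝔠.lane.carrier) (eps1Of S.1 𝔠.lane.carrier) (epsSOf S.1 𝔠.lane.carrier) (avOfPrint N S.1) k h U ≤
            Real.exp (cm * S.1.sites k + 𝔠.lane.carrier.dg * 𝔠.lane.carrier.c₁ *
              ∑ j ∈ Finset.range k, (ZVol 𝔠.lane.carrier.M₁ (rcolOf S.1 𝔠.lane.carrier) k h j : ℝ))) →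
        Node00.PrintedUV3V N L := by
  obtain ⟨X, hav, -, hUk⟩ := exists_externalInputsAC_ofPrint N L εbg
  refine ⟨X, hav, fun 𝔖 𝔄 R hmass => printedUV3V_at_slotOfRecord_of_alphaAC_of_massBoundZAE_of_consts (𝔄 := 𝔄) hav hUk hε R hcm fun S k hk1 hkK h => ?_⟩
  have hX : (X S.1).av = avOfPrint N S.1 := hav S.1
  rw [hX]
  exact hmass S k hk1 hkK h

end Slot

end Summit.QuantumFields.YangMills.BalabanUVNodes.N08SlotOfRecordFromAlphaACMassBoundZAE

end
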